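import Literature.Topology.FourManifolds.SegFrame
import Literature.Topology.FourManifolds.TwistPath
import Literature.Topology.FourManifolds.StageOrientationSign
import HarnessLib

/-!
# Twisting the output of a segment conjugation

Topic `Literature/Topology/FourManifolds` (trunk T-4MAN). Fact seat
`provefact-Literature.Topology.FourManifolds.Knot.IsConnectedSum.isIsotopic` (Schubert's theorem),
geometric heart for rail knots. The output knot `outOne` of a segment conjugation frame
(`SegFrame.lean`) carries the unit re-inserted by the affine map `A y = o' + L (y - o)` of the
segment data, `L d = d'`, `det L > 0` (`StageOrientationSign.det_linConj_pos`). For any other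
continuous linear equivalence `L'` with `L' d = d'` and `det L' > 0` the twist lemma
(`TwistPath.lean`, applied to the output knot with the twist `L' ∘ L⁻¹` fixing `d'`) replaces `L`
by `L'`: `outOne ≃ outTw` (`isIsotopic_outOne_outTw`), where `outTw` is `outOne` off the window
and `ψ⁻¹ (o' + L' (ψ (bent knot) - o))` on it (`outTw_circlePt_of_not_mem`,
`coe_outTw_circlePt_of_mem`), granted the unit radius is small against the twist threshold
(`‖L‖ R₀ ≤ R₀ᵗʷ`).

Everything is proved; no named facts are introduced.

## References

* M. W. Hirsch, *Differential Topology*, GTM 33 (1976), Ch. 8 §1, Thm. 1.3. [HirschDT1976]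
-/

open scoped Manifold ContDiff Topology Real
open Function Set Metric Filter

noncomputable section

namespace Literature.Topology.FourManifolds

/-- Local notation: `𝔼 n` is the model Euclidean space `EuclideanSpace ℝ (Fin n)`. -/
local notation "𝔼 " n:arg => EuclideanSpace ℝ (Fin n)

/-- Local notation: `𝕊 n` is the unit sphere in `EuclideanSpace ℝ (Fin (n + 1))`. -/
local notation "𝕊 " n:arg => (Metric.sphere (0 : EuclideanSpace ℝ (Fin (n + 1))) 1)

attribute [local instance] fact_finrank_euclideanSpace_succ

open KnotsInBall ExitBend SegmentConj TwistPath

namespace SegmentConj.SegData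

variable (D : SegData)

/-- **The linearisation of segment data has positive determinant.** [folklore] -/
theorem det_L_pos : 0 < LinearMap.det (((D.L : (𝔼 3) ≃L[ℝ] 𝔼 3) : (𝔼 3) →L[ℝ] 𝔼 3) : (𝔼 3) →ₗ[ℝ] 𝔼 3) :=
  StageOrientationSign.det_linConj_pos D.Ψ D.good

/-- **The twist** `L' ∘ L⁻¹` of a second linear re-insertion map. [folklore] -/
def twist (L' : (𝔼 3) →L[ℝ] 𝔼 3) : (𝔼 3) →L[ℝ] 𝔼 3 := L'.comp ((D.L.symm : (𝔼 3) ≃L[ℝ] 𝔼 3) : (𝔼 3) →L[ℝ] 𝔼 3)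

/-- The twist fixes `d'` (`L' d = d'`). [folklore] -/
theorem twist_d' {L' : (𝔼 3) →L[ℝ] 𝔼 3} (hL' : L' D.d = D.d') : D.twist L' D.d' = D.d' := by
  rw [twist, ContinuousLinearMap.comp_apply, ContinuousLinearEquiv.coe_coe, D.L_symm_d', hL']

/-- The twist after the re-insertion: `twist (L (y - o)) = L' (y - o)`. [folklore] -/
theorem twist_L (L' : (𝔼 3) →L[ℝ] 𝔼 3) (z : 𝔼 3) : D.twist L' (D.L z) = L' z := by
  rw [twist, ContinuousLinearMap.comp_apply, ContinuousLinearEquiv.coe_coe, ContinuousLinearEquiv.symm_apply_apply]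

/-- The twist has positive determinant (`det L' > 0`). [folklore] -/
theorem det_twist_pos {L' : (𝔼 3) →L[ℝ] 𝔼 3} (hdet : 0 < LinearMap.det (L' : (𝔼 3) →ₗ[ℝ] 𝔼 3)) :
    0 < LinearMap.det (D.twist L' : (𝔼 3) →ₗ[ℝ] 𝔼 3) := by
  have e : (D.twist L' : (𝔼 3) →ₗ[ℝ] 𝔼 3) = (L' : (𝔼 3) →ₗ[ℝ] 𝔼 3).comp ((D.L.symm : (𝔼 3) ≃L[ℝ] 𝔼 3) : (𝔼 3) →ₗ[ℝ] 𝔼 3) := rfl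
  rw [e, LinearMap.det_comp]
  refine mul_pos hdet ?_
  have h := D.det_L_pos
  set M₁ : (𝔼 3) →ₗ[ℝ] 𝔼 3 := ((D.L.symm : (𝔼 3) ≃L[ℝ] 𝔼 3) : (𝔼 3) →ₗ[ℝ] 𝔼 3) with hM₁
  set M₂ : (𝔼 3) →ₗ[ℝ] 𝔼 3 := (((D.L : (𝔼 3) ≃L[ℝ] 𝔼 3) : (𝔼 3) →L[ℝ] 𝔼 3) : (𝔼 3) →ₗ[ℝ] 𝔼 3) with hM₂
  have hcomp : M₁.comp M₂ = LinearMap.id := LinearMap.ext fun x ↦ by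
    simp only [hM₁, hM₂, LinearMap.coe_comp, comp_apply, LinearMap.id_coe, id_eq]
    exact D.L.symm_apply_apply x
  have hprod := LinearMap.det_comp M₁ M₂
  rw [hcomp, LinearMap.det_id] at hprod
  have hpos : (0 : ℝ) < LinearMap.det M₁ * LinearMap.det M₂ := by rw [← hprod]; exact one_pos
  rcases mul_pos_iff.1 hpos with ⟨h1, -⟩ | ⟨-, h2⟩
  · exact h1
  · exact absurd h (not_lt.2 h2.le)

end SegmentConj.SegData

namespace BandData

section Twist

variable {A B K : Knot} {b : BandData A B K ∅}
  {hcross : b.band ⁻¹' sphereEquator 2 ∩ squareNhd b.δ = {x ∈ squareNhd b.δ | x 0 = 2⁻¹}}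
  {ε r A' κ : ℝ} {F : ℝ → 𝔼 4} {W : b.WallRef hcross ε r A' κ F}
  (D : SegData) (hDo : D.o = W.segO) (hDd : D.d = W.segD) (hDlo : D.ρlo = -1) (hDhi : D.ρhi = 1 / 2)
  {Htgt : Knot} (hΨ : ∀ x, stageOne D.Ψ (W.host x) = Htgt x)
  {ρ₂ R₀ lam₀ rA : ℝ} (U : W.UnitScale ρ₂ R₀ lam₀ rA) (hρ4 : ρ₂ ≤ 1 / 4) {R₁ rc : ℝ}
  (hfar : ∀ t ∈ Icc b.alo (b.alo + 1), t ∉ Ioo (b.strLo W.HU) (b.winHi W.HU WallRef.half_mem) →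
    Htgt (circlePt t) = northPole ∨ R₁ ≤ ‖psiN (Htgt (circlePt t)) - D.o'‖)
  (hS : D.Small (-ρ₂) ρ₂ R₀ R₁ rc)
  {L' : (𝔼 3) →L[ℝ] 𝔼 3} (hL' : L' D.d = D.d') (hdet : 0 < LinearMap.det (L' : (𝔼 3) →ₗ[ℝ] 𝔼 3))

namespace WallRef.UnitScale

/-- **The twist data** of the output knot: centre `o'`, direction `d'`, twist `L' ∘ L⁻¹`, clocks
`[-ρ₂, ρ₂]`, far radius `R₁`. [folklore] -/
def twData (_ : W.UnitScale ρ₂ R₀ lam₀ rA) (hS : D.Small (-ρ₂) ρ₂ R₀ R₁ rc) (hL' : L' D.d = D.d')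
    (hdet : 0 < LinearMap.det (L' : (𝔼 3) →ₗ[ℝ] 𝔼 3)) : TwData where
  o := D.o'
  d := D.d'
  L := D.twist L'
  ρ₁ := -ρ₂
  ρ₂ := ρ₂
  R₁ := R₁
  d_ne := D.d'_ne
  L_d := D.twist_d' hL'
  det_pos := D.det_twist_pos hdet
  ρ₁_neg := by linarith [hS.ρ₂_pos]
  ρ₂_pos := hS.ρ₂_pos
  R₁_pos := hS.R₁_pos
  seg_far := hS.seg_far

/-- The fields of the twist data. [folklore] -/
@[simp] theorem twData_o : (U.twData D hS hL' hdet).o = D.o' := rfl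
/-- The fields of the twist data. [folklore] -/
@[simp] theorem twData_d : (U.twData D hS hL' hdet).d = D.d' := rfl
/-- The fields of the twist data. [folklore] -/
@[simp] theorem twData_L : (U.twData D hS hL' hdet).L = D.twist L' := rfl
/-- The fields of the twist data. [folklore] -/
@[simp] theorem twData_ρ₁ : (U.twData D hS hL' hdet).ρ₁ = -ρ₂ := rfl
/-- The fields of the twist data. [folklore] -/
@[simp] theorem twData_ρ₂ : (U.twData D hS hL' hdet).ρ₂ = ρ₂ := rfl
/-- The fields of the twist data. [folklore] -/
@[simp] theorem twData_R₁ : (U.twData D hS hL' hdet).R₁ = R₁ := rfl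

include hDo hDd in
/-- The output knot at a window parameter where the bent knot is a segment point. [folklore] -/
theorem coe_outOne_of_seg {s : ℝ} (hs : s ∈ Icc (U.w₁ hρ4) (U.w₂ hρ4)) {ρ : ℝ}
    (he : Knot.curve (W.bent U.hl₀ U.hrA) s = ((psiN.symm (W.segO + ρ • W.segD) : 𝕊 3) : 𝔼 4)) :
    ((U.outOne D hDo hDd hDlo hDhi hΨ hρ4 hfar hS (circlePt s) : 𝕊 3) : 𝔼 4) = ((psiN.symm (D.o' + ρ • D.d') : 𝕊 3) : 𝔼 4) := by
  have hb : W.bent U.hl₀ U.hrA (circlePt s) = psiN.symm (W.segO + ρ • W.segD) := Subtype.ext (by rw [← he, Knot.curve_apply])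
  rw [U.coe_outOne_circlePt_of_mem D hDo hDd hDlo hDhi hΨ hρ4 hfar hS hs, hb, psiN_apply_psiN_symm, ← hDo, ← hDd, D.A_seg]

include hDo hDd hDlo hDhi hΨ in
/-- **THE TWIST FRAME OF THE OUTPUT KNOT** (unit radius small against the twist threshold).
[folklore] -/
def twFrame (hR0 : ‖((D.L : (𝔼 3) ≃L[ℝ] 𝔼 3) : (𝔼 3) →L[ℝ] 𝔼 3)‖ * R₀ ≤ (U.twData D hS hL' hdet).R₀) :
    (U.twData D hS hL' hdet).Frame where
  I₀ := Knot.curve (U.outOne D hDo hDd hDlo hDhi hΨ hρ4 hfar hS)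
  a := b.alo
  ε₀ := min (U.w₁ hρ4 - b.alo) (b.alo + 1 - U.w₂ hρ4) / 2
  w₁ := U.w₁ hρ4
  c₁ := U.c₁ hρ4
  c₂ := U.c₂ hρ4
  w₂ := U.w₂ hρ4
  contDiff := (U.outOne D hDo hDd hDlo hDhi hΨ hρ4 hfar hS).contDiff_curve
  isRegularLoop := by
    rw [periodise_eq_of_periodic _ (U.outOne D hDo hDd hDlo hDhi hΨ hρ4 hfar hS).periodic_curve]
    exact (U.outOne D hDo hDd hDlo hDhi hΨ hρ4 hfar hS).isRegularLoop_curve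
  injOn := (U.outOne D hDo hDd hDlo hDhi hΨ hρ4 hfar hS).injOn_curve_Ico b.alo
  ε₀_pos := by
    obtain ⟨h1, h2, -⟩ := U.window_marks' hρ4
    exact div_pos (lt_min (by linarith) (by linarith)) (by norm_num)
  seam t _ := (U.outOne D hDo hDd hDlo hDhi hΨ hρ4 hfar hS).periodic_curve t
  le_w₁ := by
    obtain ⟨h1, h2, -⟩ := U.window_marks' hρ4
    have := min_le_left (U.w₁ hρ4 - b.alo) (b.alo + 1 - U.w₂ hρ4)
    linarith
  w₁_lt := (U.window_marks hρ4).2.1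
  c₁_lt := (U.window_marks' hρ4).2.2
  c₂_lt := (U.window_marks hρ4).2.2.2.2.1
  w₂_le := by
    obtain ⟨h1, h2, -⟩ := U.window_marks' hρ4
    have := min_le_right (U.w₁ hρ4 - b.alo) (b.alo + 1 - U.w₂ hρ4)
    linarith
  collar s hs := by
    obtain ⟨ρ, hρ, he⟩ := U.collar hρ4 hs
    have hs' : s ∈ Icc (U.w₁ hρ4) (U.w₂ hρ4) := by
      rcases hs with h | h
      · exact ⟨h.1, by linarith [h.2, (U.window_marks' hρ4).2.2, (U.window_marks hρ4).2.2.2.2.1]⟩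
      · exact ⟨by linarith [h.1, (U.window_marks' hρ4).2.2, (U.window_marks hρ4).2.1], h.2⟩
    exact ⟨ρ, hρ, by rw [Knot.curve_apply, U.coe_outOne_of_seg D hDo hDd hDlo hDhi hΨ hρ4 hfar hS hs' he]; rfl⟩
  inner s hs := by
    rcases U.inner hρ4 hs with ⟨ρ, hρ, he⟩ | ⟨y, hy, he⟩
    · exact Or.inl ⟨ρ, hρ, by rw [Knot.curve_apply, U.coe_outOne_of_seg D hDo hDd hDlo hDhi hΨ hρ4 hfar hS hs he]; rfl⟩
    · right
      have hb : W.bent U.hl₀ U.hrA (circlePt s) = psiN.symm y := Subtype.ext (by rw [← he, Knot.curve_apply])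
      refine ⟨D.A y, ?_, ?_⟩
      · rw [mem_closedBall, dist_eq_norm]
        refine le_trans ?_ hR0
        refine (show ‖D.A y - (U.twData D hS hL' hdet).o‖ = ‖D.A y - D.o'‖ from rfl).le.trans ((D.norm_A_sub_le y).trans ?_)
        refine mul_le_mul_of_nonneg_left ?_ (norm_nonneg _)
        rw [hDo]; rwa [mem_closedBall, dist_eq_norm] at hy
      · rw [Knot.curve_apply, U.coe_outOne_circlePt_of_mem D hDo hDd hDlo hDhi hΨ hρ4 hfar hS hs, hb, psiN_apply_psiN_symm]
  off t ht hts := by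
    rw [Knot.curve_apply, U.outOne_circlePt_of_not_mem D hDo hDd hDlo hDhi hΨ hρ4 hfar hS ht hts]
    rcases U.off D hΨ hρ4 hfar ht hts with ⟨ρ, hρ, hρn, he⟩ | ⟨x, hx, hfarx⟩
    · left
      have hb : W.bent U.hl₀ U.hrA (circlePt t) = psiN.symm (D.o + ρ • D.d) := Subtype.ext (by rw [hDo, hDd, ← he, Knot.curve_apply])
      refine ⟨ρ, hρn, ?_⟩
      rw [hb, D.seg ρ ⟨by rw [hDlo]; exact hρ.1, by rw [hDhi]; exact hρ.2⟩]
      rfl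
    · right
      have hb : W.bent U.hl₀ U.hrA (circlePt t) = x := Subtype.ext (by rw [← hx, Knot.curve_apply])
      exact ⟨stageOne D.Ψ x, by rw [hb], hfarx⟩

include hDo hDd hDlo hDhi hΨ in
/-- **THE TWISTED OUTPUT KNOT**: `outOne` with the unit re-inserted by `L'` instead of `L`. [folklore] -/
def outTw (hR0 : ‖((D.L : (𝔼 3) ≃L[ℝ] 𝔼 3) : (𝔼 3) →L[ℝ] 𝔼 3)‖ * R₀ ≤ (U.twData D hS hL' hdet).R₀) : Knot :=
  (U.twFrame D hDo hDd hDlo hDhi hΨ hρ4 hfar hS hL' hdet hR0).outKnot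

/-- The base knot of the twist frame is the output knot. [folklore] -/
theorem baseKnot_twFrame (hR0 : ‖((D.L : (𝔼 3) ≃L[ℝ] 𝔼 3) : (𝔼 3) →L[ℝ] 𝔼 3)‖ * R₀ ≤ (U.twData D hS hL' hdet).R₀) :
    (U.twFrame D hDo hDd hDlo hDhi hΨ hρ4 hfar hS hL' hdet hR0).baseKnot = U.outOne D hDo hDd hDlo hDhi hΨ hρ4 hfar hS := by
  set Fr := U.twFrame D hDo hDd hDlo hDhi hΨ hρ4 hfar hS hL' hdet hR0
  set O := U.outOne D hDo hDd hDlo hDhi hΨ hρ4 hfar hS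
  apply DFunLike.coe_injective
  funext u
  obtain ⟨t, ht, htu⟩ := O.exists_mem_Ico_apply_circlePt_eq b.alo (x := O u) ⟨u, rfl⟩
  have hu : circlePt t = u := O.injective htu
  rw [← hu]
  apply Subtype.ext
  rw [Fr.coe_baseKnot_circlePt (show t ∈ Ico Fr.a (Fr.a + 1) from ht)]
  show Knot.curve O t = _
  rw [Knot.curve_apply]

/-- **THE OUTPUT KNOT IS ISOTOPIC TO THE TWISTED OUTPUT KNOT.** [cite: HirschDT1976, Ch. 8 §1, Thm. 1.3] -/
theorem isIsotopic_outOne_outTw (hR0 : ‖((D.L : (𝔼 3) ≃L[ℝ] 𝔼 3) : (𝔼 3) →L[ℝ] 𝔼 3)‖ * R₀ ≤ (U.twData D hS hL' hdet).R₀) :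
    (U.outOne D hDo hDd hDlo hDhi hΨ hρ4 hfar hS).IsIsotopic (U.outTw D hDo hDd hDlo hDhi hΨ hρ4 hfar hS hL' hdet hR0) := by
  have h := (U.twFrame D hDo hDd hDlo hDhi hΨ hρ4 hfar hS hL' hdet hR0).isIsotopic_baseKnot_outKnot
  rwa [U.baseKnot_twFrame D hDo hDd hDlo hDhi hΨ hρ4 hfar hS hL' hdet hR0] at h

/-- **The twisted output knot off the window** is the output knot. [folklore] -/
theorem outTw_circlePt_of_not_mem (hR0 : ‖((D.L : (𝔼 3) ≃L[ℝ] 𝔼 3) : (𝔼 3) →L[ℝ] 𝔼 3)‖ * R₀ ≤ (U.twData D hS hL' hdet).R₀)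
    {t : ℝ} (ht : t ∈ Ico b.alo (b.alo + 1)) (hts : t ∉ Icc (U.w₁ hρ4) (U.w₂ hρ4)) :
    U.outTw D hDo hDd hDlo hDhi hΨ hρ4 hfar hS hL' hdet hR0 (circlePt t) = U.outOne D hDo hDd hDlo hDhi hΨ hρ4 hfar hS (circlePt t) := by
  rw [outTw, (U.twFrame D hDo hDd hDlo hDhi hΨ hρ4 hfar hS hL' hdet hR0).outKnot_circlePt_of_not_mem ht hts,
    U.baseKnot_twFrame D hDo hDd hDlo hDhi hΨ hρ4 hfar hS hL' hdet hR0]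

/-- **The twisted output knot on the window**: `ψ⁻¹ (o' + L' (ψ (bent knot) - o))`. [folklore] -/
theorem coe_outTw_circlePt_of_mem (hR0 : ‖((D.L : (𝔼 3) ≃L[ℝ] 𝔼 3) : (𝔼 3) →L[ℝ] 𝔼 3)‖ * R₀ ≤ (U.twData D hS hL' hdet).R₀)
    {s : ℝ} (hs : s ∈ Icc (U.w₁ hρ4) (U.w₂ hρ4)) :
    ((U.outTw D hDo hDd hDlo hDhi hΨ hρ4 hfar hS hL' hdet hR0 (circlePt s) : 𝕊 3) : 𝔼 4) =
      ((psiN.symm (D.o' + L' (psiN (W.bent U.hl₀ U.hrA (circlePt s)) - D.o)) : 𝕊 3) : 𝔼 4) := by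
  set Fr := U.twFrame D hDo hDd hDlo hDhi hΨ hρ4 hfar hS hL' hdet hR0
  have hY : Fr.Y s = D.A (psiN (W.bent U.hl₀ U.hrA (circlePt s))) := by
    rw [TwData.Frame.Y, U.baseKnot_twFrame D hDo hDd hDlo hDhi hΨ hρ4 hfar hS hL' hdet hR0]
    have h := U.coe_outOne_circlePt_of_mem D hDo hDd hDlo hDhi hΨ hρ4 hfar hS hs
    rw [Subtype.ext h, psiN_apply_psiN_symm]
  rw [outTw, Fr.coe_outKnot_circlePt_of_mem hs, hY]
  show ((psiN.symm (D.o' + D.twist L' (D.A (psiN (W.bent U.hl₀ U.hrA (circlePt s))) - D.o')) : 𝕊 3) : 𝔼 4) = _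
  rw [SegData.A, add_sub_cancel_left, D.twist_L]

end WallRef.UnitScale

end Twist

end BandData

end Literature.Topology.FourManifolds
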